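import Summits.QuantumFields.YangMills.Theorems.NPointIsotropy.Negative.SixPointJunk

/-!
# Negative results on `PencilRigidity.NPointIsotropy` (crux-triage r1 / triager 3, gen 2), part B:
# the first lemma `QuarterTurnPositive` of card `quarter-turn-root` is false as typed

`IsQuarterTurn`, `IsQuadrantSupported`, `QuarterTurnPositive` are copied VERBATIM from
`Summits/QuantumFields/YangMills/Cruxes/NPointIsotropy/SketchIdeator3.lean` (ideator 3, round 1; namespace changed,
the Sketch's notation `E` written as the tree's `abbrev E4`); `EightFrameRP` is the verbatim copy already landed in
`AngularBandLimitFalse.lean` (`Negative.Triage3.EightFrameRP`). The crux workfile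
`Cruxes/NPointIsotropy/TRIAGE-r1-3-QuarterTurnPositiveFalse.lean` proves the same theorem against the imported Sketch
declaration itself. The lemma asserts: E3 + translations + RP in the eight planar frames make the hypercubic
quarter-turn `R_q : e₀ ↦ -e₁, e₁ ↦ e₀` a POSITIVE HERMITIAN operator on the vectors of ALL `e₀`-time-ordered test
functions supported in the quadrant `{x₀ > 0, x₁ > 0}`: `Σ conj cᵢ cⱼ 𝔖(θ(R_q Fᵢ)* ⊗ Fⱼ) ≥ 0`.

Main result: `not_QuarterTurnPositive : ¬ QuarterTurnPositive` (sorry-free; axioms propext, Classical.choice, Quot.sound).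

WHY IT IS FALSE. `θ₀ ∘ R_q` is the anti-diagonal mirror `Θ' : (x₀,x₁) ↦ (-x₁,-x₀)`, and RP across it only constrains
test functions time-ORDERED in that frame (`x₀ + x₁` strictly increasing along the points); `e₀`-ordering plus quadrant
support does not give that, and E3 cannot re-sort configurations on the codimension-1 set where two points have EQUAL
anti-diagonal time — where the typed OS clauses leave singular parts of `𝔖ₙ` free. Witness: the family `S6` of part A
(`SixPointJunk.lean`: `𝔖₆ = -T`, symmetric, translation and fully hypercubic invariant, RP in all eight frames with
vanishing OS forms) against the `e₀`-time-ordered, quadrant-supported three-point test function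
`F₃` = (bumps at `Y = ((10,50),(50,10),(60,10))`) + (bumps at `X = ((10,20),(30,20),(40,30))`): the quarter-turn form is
`𝔖₆(θ(R_q F₃)* ⊗ F₃) = -T(H₃₃)` with `Re T(H₃₃) > 0` (`Z = (Θ'Y reversed, X)` is charged by the identity term, all terms
`≥ 0`). The pair `(10,50), (50,10)` of `Y` has equal anti-diagonal time `x₀ + x₁ = 60`: exactly the unsortable boundary.

MORAL for the line (shared with card `quarter-turn-corner-operator`, whose first lemma `QuarterTurnPositiveSymmetric`
carries the missing hypothesis `IsTimeOrdered (linActMulti Rq G)` and is provable now): REPAIRED first lemma = add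
`∀ j, IsTimeOrdered (linActMulti Rq (F j))`; the positive quarter-turn is then densely defined on the span of
anti-diagonally orderable quadrant vectors, which is all the line needs. The lever survives; the filed statement does not.
-/

noncomputable section

-- Mathlib's `SimplexCategory` instance `Fintype (Fin (x.len + 1))` matches `Fintype (Fin 4)` (tree-known
-- workaround, as in the other Negative files).
attribute [-instance] SimplexCategory.instFintypeToTypeOrderHomFinHAddNatLenOfNat

namespace Summit.QuantumFields.YangMills.Theorems.NPointIsotropy.Negative.Triage3g2

open scoped BigOperators ComplexConjugate InnerProductSpace
open MeasureTheory Filter Topology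
open Literature.MathematicalPhysics.QuantumLattice Literature.MathematicalPhysics.AQFT
  Literature.MathematicalPhysics.QuantumFieldTheory
open Summit.QuantumFields.YangMills.Theorems.NPointIsotropy.Negative
open Summit.QuantumFields.YangMills.Theorems.NPointIsotropy.Negative.Triage3 (EightFrameRP)

/-! ## §0 The statements under test (verbatim from `SketchIdeator3.lean`) -/

/-- The quarter-turn `R_q : e₀ ↦ -e₁, e₁ ↦ e₀` (fixing `e₂, e₃`): it maps the quadrant
`{x₀ > 0, x₁ > 0}` onto `{x₀ > 0, x₁ < 0}`, inside the positive-time half-space. -/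
def IsQuarterTurn (R : E4 ≃ₗᵢ[ℝ] E4) : Prop :=
  R (EuclideanSpace.single 0 1) = -EuclideanSpace.single 1 1 ∧
    R (EuclideanSpace.single 1 1) = EuclideanSpace.single 0 1 ∧
    R (EuclideanSpace.single 2 1) = EuclideanSpace.single 2 1 ∧
    R (EuclideanSpace.single 3 1) = EuclideanSpace.single 3 1

/-- `F` is supported in the `n`-fold quadrant `{x₀ > 0, x₁ > 0}ⁿ`. -/
def IsQuadrantSupported {n : ℕ} (F : SchwartzMap (Fin n → E4) ℂ) : Prop :=
  ∀ x : Fin n → E4, F x ≠ 0 → ∀ i : Fin n, 0 < x i 0 ∧ 0 < x i 1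

/-- **First lemma of card `quarter-turn-root`** — verbatim. Reflection positivity across the diagonal mirror
`x₀ + x₁ = 0` (one of the eight frames), rewritten in the `e₀`-quantisation by `Θ_d = θ₀ ∘ R_q⁻¹`,
says: on quadrant-supported vectors the hypercubic quarter-turn `Ψ(F) ↦ Ψ(F ∘ R_q⁻¹)` is a
POSITIVE HERMITIAN operator — the matrix `𝔖(θ(F_i ∘ R_q⁻¹)* ⊗ F_j)` is positive semidefinite
(its `(i,i)` entries are the diagonal-frame OS form). -/
def QuarterTurnPositive : Prop :=
  ∀ (S : SchwingerFamily E4), S.toLabelled.IsSymmetric →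
    (∀ (n : ℕ) (a : E4) (F : SchwartzMap (Fin n → E4) ℂ), IsOffDiagonal F →
      S n (translateMulti a F) = S n F) →
    EightFrameRP S →
    ∀ (Rq : E4 ≃ₗᵢ[ℝ] E4), IsQuarterTurn Rq →
      ∀ (N : ℕ) (deg : Fin N → ℕ) (F : (j : Fin N) → SchwartzMap (Fin (deg j) → E4) ℂ)
        (c : Fin N → ℂ),
        (∀ j, IsTimeOrdered (F j)) → (∀ j, IsQuadrantSupported (F j)) →
        ∀ H : (i j : Fin N) → SchwartzMap (Fin (deg i + deg j) → E4) ℂ,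
          (∀ i j, IsAppendTensorOf (H i j) (osAdjoint (linActMulti Rq (F i))) (F j)) →
          let z := ∑ i, ∑ j, (starRingEnd ℂ) (c i) * c j * S (deg i + deg j) (H i j)
          0 ≤ z.re ∧ z.im = 0

/-! ## §3 The quarter-turn `R_q` is a quarter-turn in the sense of the card -/
/-- `R_q` is a quarter-turn in the sense of the card. -/
theorem isQuarterTurn_Rq : IsQuarterTurn Rq := by
  refine ⟨?_, ?_, ?_, ?_⟩ <;> ext k <;> fin_cases k <;> simp [Rq, sp_apply, sgn, Equiv.swap_apply_def]

/-! ## §4 The test function `F₃`: two bump triples in the quadrant -/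

/-- Centres of the first triple `Y` (its first two points have EQUAL anti-diagonal time `x₀ + x₁ = 60`). -/
def cY : Fin 3 → E4 := ![pt 10 50, pt 50 10, pt 60 10]

/-- Centres of the second triple `X`. -/
def cX : Fin 3 → E4 := ![pt 10 20, pt 30 20, pt 40 30]

/-- Product of unit-radius bumps at the centres `c`. -/
def blob (c : Fin 3 → E4) (u : Fin 3 → E4) : ℝ := ∏ i, (bump (c i)) (u i)

/-- Blobs are non-negative. -/
theorem blob_nonneg (c u : Fin 3 → E4) : 0 ≤ blob c u := Finset.prod_nonneg fun i _ => (bump (c i)).nonneg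

/-- Blobs are smooth. -/
theorem blob_contDiff (c : Fin 3 → E4) : ContDiff ℝ (⊤ : ℕ∞) (blob c) :=
  contDiff_prod fun i _ => (bump (c i)).contDiff.comp ((ContinuousLinearMap.proj i : (Fin 3 → E4) →L[ℝ] E4).contDiff)

/-- Where a blob is non-zero, every point lies in the unit ball about its centre. -/
theorem blob_ball {c u : Fin 3 → E4} (h : blob c u ≠ 0) (i : Fin 3) : u i ∈ Metric.ball (c i) 1 := by
  have h' := (Finset.prod_ne_zero_iff.1 h) i (Finset.mem_univ _)
  have : u i ∈ Function.support (bump (c i)) := h'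
  rwa [(bump (c i)).support_eq] at this

/-- A blob takes the value `1` at its centres. -/
theorem blob_self (c : Fin 3 → E4) : blob c c = 1 :=
  Finset.prod_eq_one fun i _ => (bump (c i)).one_of_mem_closedBall (by simp [bump])

/-- The closed box of radius `1` about the centres. -/
def box (c : Fin 3 → E4) : Set (Fin 3 → E4) := Set.pi Set.univ fun i => Metric.closedBall (c i) 1

/-- The box is compact. -/
theorem isCompact_box (c : Fin 3 → E4) : IsCompact (box c) :=
  isCompact_univ_pi fun i => isCompact_closedBall (c i) 1

/-- The box is closed. -/
theorem isClosed_box (c : Fin 3 → E4) : IsClosed (box c) := isClosed_set_pi fun _ _ => Metric.isClosed_closedBall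

/-- The support of a blob lies in its box. -/
theorem blob_box {c u : Fin 3 → E4} (h : blob c u ≠ 0) : u ∈ box c :=
  fun i _ => Metric.ball_subset_closedBall (blob_ball h i)

/-- `f₃ = blob_Y + blob_X`. -/
def f3 (u : Fin 3 → E4) : ℝ := blob cY u + blob cX u

/-- `f₃ ≥ 0`. -/
theorem f3_nonneg (u : Fin 3 → E4) : 0 ≤ f3 u := add_nonneg (blob_nonneg _ _) (blob_nonneg _ _)

/-- Where `f₃ ≠ 0`, one of the two blobs is non-zero. -/
theorem f3_ne_zero {u : Fin 3 → E4} (h : f3 u ≠ 0) : blob cY u ≠ 0 ∨ blob cX u ≠ 0 := by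
  by_contra h'
  simp only [not_or, not_not] at h'
  exact h (by rw [f3, h'.1, h'.2, add_zero])

/-- `f₃ ≥ 1` at the two centre triples. -/
theorem one_le_f3_cY : 1 ≤ f3 cY := by
  rw [f3, blob_self]; linarith [blob_nonneg cX cY]

/-- `f₃ ≥ 1` at the second centre triple. -/
theorem one_le_f3_cX : 1 ≤ f3 cX := by
  rw [f3, blob_self]; linarith [blob_nonneg cY cX]

/-- The complexified test function as a bare function. -/
def F3fun (u : Fin 3 → E4) : ℂ := (f3 u : ℂ)

/-- The complexified test function has compact support. -/
theorem F3fun_hasCompactSupport : HasCompactSupport F3fun := by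
  refine HasCompactSupport.intro ((isCompact_box cY).union (isCompact_box cX)) fun u hu => ?_
  simp only [Set.mem_union, not_or] at hu
  have hY : blob cY u = 0 := by
    by_contra h
    exact hu.1 (blob_box h)
  have hX : blob cX u = 0 := by
    by_contra h
    exact hu.2 (blob_box h)
  simp [F3fun, f3, hY, hX]

/-- The complexified test function is smooth. -/
theorem F3fun_contDiff : ContDiff ℝ (⊤ : ℕ∞) F3fun :=
  (Complex.ofRealCLM.contDiff.of_le le_top).comp ((blob_contDiff cY).add (blob_contDiff cX))

/-- **The test function** `F₃ ∈ 𝓢((ℝ⁴)³)`. -/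
def F3 : SchwartzMap (Fin 3 → E4) ℂ := F3fun_hasCompactSupport.toSchwartzMap F3fun_contDiff

/-- Values of `F₃`. -/
theorem F3_apply (u : Fin 3 → E4) : F3 u = (f3 u : ℂ) := rfl

/-- The topological support of `F₃` lies in the two boxes. -/
theorem tsupport_F3 : tsupport (F3 : (Fin 3 → E4) → ℂ) ⊆ box cY ∪ box cX := by
  refine closure_minimal (fun u hu => ?_) ((isClosed_box _).union (isClosed_box _))
  have hu' : f3 u ≠ 0 := by simpa [F3_apply] using hu
  rcases f3_ne_zero hu' with h | h
  · exact Or.inl (blob_box h)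
  · exact Or.inr (blob_box h)

/-- Time coordinates of the centres. -/
theorem cY_time : cY 0 0 = 10 ∧ cY 1 0 = 50 ∧ cY 2 0 = 60 := by
  refine ⟨?_, ?_, ?_⟩ <;> simp [cY]
/-- Time coordinates of the second centre triple. -/
theorem cX_time : cX 0 0 = 10 ∧ cX 1 0 = 30 ∧ cX 2 0 = 40 := by
  refine ⟨?_, ?_, ?_⟩ <;> simp [cX]
/-- `x₁`-coordinates of the first centre triple. -/
theorem cY_one : cY 0 1 = 50 ∧ cY 1 1 = 10 ∧ cY 2 1 = 10 := by
  refine ⟨?_, ?_, ?_⟩ <;> simp [cY]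
/-- `x₁`-coordinates of the second centre triple. -/
theorem cX_one : cX 0 1 = 20 ∧ cX 1 1 = 20 ∧ cX 2 1 = 30 := by
  refine ⟨?_, ?_, ?_⟩ <;> simp [cX]

/-- In a box about centres with increasing, positive times (gaps `> 2`), times are positive and increasing. -/
theorem ordered_of_box {c : Fin 3 → E4} {u : Fin 3 → E4} (hu : u ∈ box c)
    (h0 : 1 < c 0 0) (h01 : c 0 0 + 2 < c 1 0) (h12 : c 1 0 + 2 < c 2 0) :
    (∀ i, 0 < u i 0) ∧ StrictMono fun i => u i 0 := by
  have hb : ∀ i, u i ∈ Metric.closedBall (c i) 1 := fun i => hu i (Set.mem_univ _)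
  have e0 := coord_of_mem_closedBall (hb 0) 0
  have e1 := coord_of_mem_closedBall (hb 1) 0
  have e2 := coord_of_mem_closedBall (hb 2) 0
  refine ⟨fun i => ?_, Fin.strictMono_iff_lt_succ.2 fun i => ?_⟩
  · fin_cases i
    · show 0 < u 0 0; linarith
    · show 0 < u 1 0; linarith
    · show 0 < u 2 0; linarith
  · fin_cases i
    · show u 0 0 < u 1 0; linarith
    · show u 1 0 < u 2 0; linarith

/-- `F₃` is time-ordered in the `e₀`-frame. -/
theorem F3_isTimeOrdered : IsTimeOrdered F3 := by
  intro u hu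
  obtain ⟨hY0, hY1, hY2⟩ := cY_time
  obtain ⟨hX0, hX1, hX2⟩ := cX_time
  rcases tsupport_F3 hu with h | h
  · exact ordered_of_box h (by rw [hY0]; norm_num) (by rw [hY0, hY1]; norm_num) (by rw [hY1, hY2]; norm_num)
  · exact ordered_of_box h (by rw [hX0]; norm_num) (by rw [hX0, hX1]; norm_num) (by rw [hX1, hX2]; norm_num)

/-- In the unit ball about a centre with coordinates `0, 1` larger than `1`, both coordinates are positive. -/
theorem quadrant_of_ball {v c : E4} (h : v ∈ Metric.ball c 1) (h0 : 1 < c 0) (h1 : 1 < c 1) :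
    0 < v 0 ∧ 0 < v 1 := by
  have hb := Metric.ball_subset_closedBall h
  have e0 := coord_of_mem_closedBall hb 0
  have e1 := coord_of_mem_closedBall hb 1
  constructor <;> linarith

/-- Both planar coordinates of every centre exceed `1`. -/
theorem one_lt_cY (i : Fin 3) : 1 < cY i 0 ∧ 1 < cY i 1 := by
  fin_cases i <;> simp [cY]

/-- Both planar coordinates of every centre of the second triple exceed `1`. -/
theorem one_lt_cX (i : Fin 3) : 1 < cX i 0 ∧ 1 < cX i 1 := by
  fin_cases i <;> simp [cX]

/-- `F₃` is supported in the quadrant `{x₀ > 0, x₁ > 0}³`. -/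
theorem F3_quadrant : IsQuadrantSupported F3 := by
  intro u hu i
  have hu' : f3 u ≠ 0 := by simpa [F3_apply] using hu
  rcases f3_ne_zero hu' with h | h
  · exact quadrant_of_ball (blob_ball h i) (one_lt_cY i).1 (one_lt_cY i).2
  · exact quadrant_of_ball (blob_ball h i) (one_lt_cX i).1 (one_lt_cX i).2

/-! ## §5 The quarter-turn form on `F₃` is negative -/
/-- The OS tensor `H₃₃ = θ(R_q F₃)* ⊗ F₃`. -/
def H33 : SchwartzMap (Fin (3 + 3) → E4) ℂ := SchwartzMap.appendTensor (osAdjoint (linActMulti Rq F3)) F3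

/-- `H₃₃` is a tensor-product witness in the sense of `IsAppendTensorOf`. -/
theorem H33_isAppend : IsAppendTensorOf H33 (osAdjoint (linActMulti Rq F3)) F3 :=
  isAppendTensorOf_appendTensor _ _

/-- The real integrand behind `H₃₃`. -/
def rfun (w : Fin (3 + 3) → E4) : ℝ :=
  f3 (fun i => Rq.symm (timeReflection 4 (w (Fin.castAdd 3 (Fin.rev i))))) * f3 (fun i => w (Fin.natAdd 3 i))

/-- The real integrand is non-negative. -/
theorem rfun_nonneg (w : Fin (3 + 3) → E4) : 0 ≤ rfun w := mul_nonneg (f3_nonneg _) (f3_nonneg _)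

/-- Values of `H₃₃` are the real numbers `rfun`. -/
theorem H33_apply (w : Fin (3 + 3) → E4) : H33 w = (rfun w : ℂ) := by
  rw [H33, SchwartzMap.appendTensor_apply, osAdjoint_apply, linActMulti_apply]
  simp only [Function.comp_def, F3_apply, Complex.conj_ofReal, rfun, Complex.ofReal_mul]

/-- The reflected first half of `Z` is the triple `Y` … -/
theorem Z_back : (fun i : Fin 3 => Rq.symm (timeReflection 4 (Z (Fin.castAdd 3 (Fin.rev i))))) = cY := by
  funext i
  fin_cases i
  · show Rq.symm (timeReflection 4 (pt (-50) (-10))) = pt 10 50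
    rw [Rq_symm_theta_pt]; norm_num
  · show Rq.symm (timeReflection 4 (pt (-10) (-50))) = pt 50 10
    rw [Rq_symm_theta_pt]; norm_num
  · show Rq.symm (timeReflection 4 (pt (-10) (-60))) = pt 60 10
    rw [Rq_symm_theta_pt]; norm_num

/-- … and its second half is the triple `X`. -/
theorem Z_front : (fun i : Fin 3 => Z (Fin.natAdd 3 i)) = cX := by
  funext i
  fin_cases i <;> rfl

/-- `rfun (Z) ≥ 1 > 0`. -/
theorem rfun_Z_pos : 0 < rfun Z := by
  unfold rfun
  rw [Z_back, Z_front]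
  exact mul_pos (lt_of_lt_of_le one_pos one_le_f3_cY) (lt_of_lt_of_le one_pos one_le_f3_cX)

/-- `f₃` is continuous. -/
theorem f3_continuous : Continuous f3 := ((blob_contDiff cY).add (blob_contDiff cX)).continuous

/-- Continuity of the identity-term integrand. -/
theorem rfun_gZ_continuous : Continuous fun a : E4 => rfun (fun i => Z i + a) := by
  unfold rfun
  refine Continuous.mul (f3_continuous.comp ?_) (f3_continuous.comp ?_)
  · exact continuous_pi fun i =>
      Rq.symm.continuous.comp ((timeReflection 4).continuous.comp (continuous_const.add continuous_id))
  · exact continuous_pi fun i => continuous_const.add continuous_id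

/-- Integrability of the identity-term integrand (it is the modulus of a Schwartz function of `a`). -/
theorem rfun_gZ_integrable : Integrable (fun a : E4 => rfun (fun i => Z i + a)) := by
  have h1 : Integrable (⇑(SchwartzMap.compCLM ℂ (g := gZ) gZ_hasTemperateGrowth gZ_upper H33))
      (volume : Measure E4) := SchwartzMap.integrable _
  refine (h1.norm).mono' rfun_gZ_continuous.aestronglyMeasurable (ae_of_all _ fun a => ?_)
  rw [SchwartzMap.compCLM_apply]
  simp only [Function.comp_apply, Real.norm_eq_abs, abs_of_nonneg (rfun_nonneg _)]
  rw [show gZ a = fun i => Z i + a from rfl, H33_apply, Complex.norm_real, Real.norm_eq_abs,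
    abs_of_nonneg (rfun_nonneg _)]

/-- The identity term of `T H₃₃` is a positive real number. -/
theorem identity_term_pos : 0 < ∫ a : E4, rfun (fun i => Z i + a) := by
  rw [integral_pos_iff_support_of_nonneg (fun a => rfun_nonneg _) rfun_gZ_integrable]
  have hopen : IsOpen (Function.support fun a : E4 => rfun (fun i => Z i + a)) := by
    have : Function.support (fun a : E4 => rfun (fun i => Z i + a)) =
        (fun a : E4 => rfun (fun i => Z i + a)) ⁻¹' {0}ᶜ := by
      ext a; simp
    rw [this]
    exact isOpen_compl_singleton.preimage rfun_gZ_continuous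
  refine hopen.measure_pos volume ⟨0, ?_⟩
  simp only [Function.mem_support, add_zero]
  exact rfun_Z_pos.ne'

/-- Real part of `T H₃₃` as a double sum of real integrals. -/
theorem T_H33_re : (T H33).re = ∑ g : WIdx, ∑ π : Equiv.Perm (Fin 6),
    ∫ a : E4, rfun (fun i => sp g.1 g.2 (Z (π i) + a)) := by
  rw [T_apply, Complex.re_sum]
  refine Finset.sum_congr rfl fun g _ => ?_
  rw [Complex.re_sum]
  refine Finset.sum_congr rfl fun π _ => ?_
  simp only [H33_apply]
  rw [integral_complex_ofReal, Complex.ofReal_re]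

/-- `Re T H₃₃ > 0`: all terms are non-negative and the identity term is positive. -/
theorem T_H33_re_pos : 0 < (T H33).re := by
  rw [T_H33_re]
  have hnn : ∀ (g : WIdx) (π : Equiv.Perm (Fin 6)),
      0 ≤ ∫ a : E4, rfun (fun i => sp g.1 g.2 (Z (π i) + a)) :=
    fun g π => integral_nonneg fun a => rfun_nonneg _
  refine Finset.sum_pos' (fun g _ => Finset.sum_nonneg fun π _ => hnn g π)
    ⟨((1 : Equiv.Perm (Fin 4)), fun _ => false), Finset.mem_univ _, ?_⟩
  refine Finset.sum_pos' (fun π _ => hnn _ π) ⟨1, Finset.mem_univ _, ?_⟩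
  have : (fun a : E4 => rfun (fun i => sp (1 : Equiv.Perm (Fin 4)) (fun _ => false)
      (Z ((1 : Equiv.Perm (Fin 6)) i) + a))) = fun a => rfun (fun i => Z i + a) := by
    funext a
    simp only [sp_one_false, Equiv.Perm.coe_one, id_eq]
  rw [this]
  exact identity_term_pos

/-! ## §6 The refutation -/
/-- The conclusion of `QuarterTurnPositive` for a given family (verbatim tail of the Sketch statement, named so
that the instantiation below compares syntactically identical elaborations). -/
def QTForm (S : SchwingerFamily E4) : Prop :=
  ∀ (Rq : E4 ≃ₗᵢ[ℝ] E4), IsQuarterTurn Rq →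
    ∀ (N : ℕ) (deg : Fin N → ℕ) (F : (j : Fin N) → SchwartzMap (Fin (deg j) → E4) ℂ)
      (c : Fin N → ℂ),
      (∀ j, IsTimeOrdered (F j)) → (∀ j, IsQuadrantSupported (F j)) →
      ∀ H : (i j : Fin N) → SchwartzMap (Fin (deg i + deg j) → E4) ℂ,
        (∀ i j, IsAppendTensorOf (H i j) (osAdjoint (linActMulti Rq (F i))) (F j)) →
        let z := ∑ i, ∑ j, (starRingEnd ℂ) (c i) * c j * S (deg i + deg j) (H i j)
        0 ≤ z.re ∧ z.im = 0

/-- `QuarterTurnPositive` hands the quarter-turn form of the witness family. -/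
theorem qtForm_S6 (h : QuarterTurnPositive) : QTForm S6 := by
  have hsymm : S6.toLabelled.IsSymmetric := fun n _ π F _ => S6_permTest n π F
  have htrans : ∀ (n : ℕ) (a : E4) (F : SchwartzMap (Fin n → E4) ℂ), IsOffDiagonal F →
      S6 n (translateMulti a F) = S6 n F := fun n a F _ => S6_translate n a F
  exact h S6 hsymm htrans S6_eightFrameRP

/-- **Specialisation of the form at `N = 1`, degree `3`** — stated over VARIABLES only, so that the
dependent binders `deg, F, H` are instantiated in a context where nothing heavy can be unfolded. -/
theorem qtForm_one {S : SchwingerFamily E4} (hq : QTForm S) {R : E4 ≃ₗᵢ[ℝ] E4} (hR : IsQuarterTurn R)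
    (F : SchwartzMap (Fin 3 → E4) ℂ) (hF : IsTimeOrdered F) (hQ : IsQuadrantSupported F)
    (H : SchwartzMap (Fin (3 + 3) → E4) ℂ) (hH : IsAppendTensorOf H (osAdjoint (linActMulti R F)) F) :
    0 ≤ (S (3 + 3) H).re := by
  obtain ⟨hre, -⟩ := hq R hR 1 (fun _ => 3) (fun _ => F) (fun _ => 1) (fun _ => hF) (fun _ => hQ)
    (fun _ _ => H) (fun _ _ => hH)
  rw [Fin.sum_univ_one, Fin.sum_univ_one, map_one, one_mul, one_mul] at hre
  exact hre

/-- Degree `3 + 3` of the witness family (syntactic form produced by `qtForm_one`). -/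
theorem S6_33 : S6 (3 + 3) = -T := rfl

/-- **The witness family violates the quarter-turn form.** -/
theorem not_qtForm_S6 : ¬ QTForm S6 := by
  intro hq
  have h := qtForm_one hq isQuarterTurn_Rq F3 F3_isTimeOrdered F3_quadrant H33 H33_isAppend
  rw [S6_33, neg_clm_apply, Complex.neg_re] at h
  linarith [T_H33_re_pos]

/-- **Theorem (crux-triage r1/3, gen 2).** The first lemma `QuarterTurnPositive` of card `quarter-turn-root`
is false [small-model fact for crux stmt-QuantumFields-11686]: the family `𝔖₆ = -T` is symmetric, translation invariant and reflection positive in all eight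
planar frames, `F₃` is `e₀`-time-ordered and quadrant-supported, and the quarter-turn form
`𝔖₆(θ(R_q F₃)* ⊗ F₃) = -T(H₃₃)` has negative real part. -/
theorem not_QuarterTurnPositive : ¬ QuarterTurnPositive := fun h => not_qtForm_S6 (qtForm_S6 h)

end Summit.QuantumFields.YangMills.Theorems.NPointIsotropy.Negative.Triage3g2

end
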